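import Literature.MathematicalPhysics.QuantumLattice.AnisotropicHeisenbergThermalNeelOrder
import HarnessLib

/-!
# `0 ≤ ρ₃ ≤ ρ₁` at positive temperature: the energetic inequalities of Kennedy–Lieb–Shastry's §3
# for the Gibbs state, by the Peierls–Bogoliubov (free-energy convexity) inequality, and the
# printed one-parameter two-sum-rule bound at `T > 0`

Topic `MathematicalPhysics/QuantumLattice`; the positive-temperature companion of
`AnisotropicHeisenbergEnergyComparison.lean` (ground state). There, for the antiferromagnet with
direction-dependent couplings `H_K = Σ_xΣᵢKᵢ𝐒_x·𝐒_{x+eᵢ}` and its direction-resolved bond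
correlations `εᵢ` (KLS's `ρᵢ = -3εᵢ`), the inequalities (X) `(K_a - K_b)(ε_a - ε_b) ≤ 0`,
(S) `K_a = K_b ⇒ ε_a = ε_b` and (P) `Kᵢεᵢ ≤ 0` — [KLS1988JSP] p. 1026: "`ρ₃ ≤ ρ₁`" (by rotating
the lattice) and "`ρ₃ ≥ 0`" — were proved from the variational principle for the ground-state energy.
At inverse temperature `β` the same three statements hold for the Gibbs state `⟨·⟩_β` of `H_K`,
with the variational principle replaced by the **Peierls–Bogoliubov inequality**
`log Z(H) - β⟨W⟩_H ≤ log Z(H + W)` (the tree's `Matrix.peierls_bogoliubov`; concavity of the free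
energy), the symmetry `Z(H_{K∘s}) = Z(H_K)` under a permutation `s` of the axes
(`heisAnisoTorus_submatrix_comp_perm`, `Matrix.partitionFn_submatrix_equiv`) and, for (P), the
plane-flip average `H_K + Σ_a W_aH_KW_a⁻¹ = 4H_{K^{(i)}}` of the ground-state file
(`heisAnisoTorus_add_sum_planeFlip`) together with unitary invariance of `Z` and convexity of
`log Z` (Peierls–Bogoliubov at the average). No named fact is introduced; everything is a theorem.

These are exactly the a-priori inputs that turn the thermal two-sum-rule bound
`heisAniso_twoSumRule_thermal` (`AnisotropicHeisenbergThermalTwoSumRule.lean`) into the PRINTED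
one-parameter form of [KLS1988JSP] (6)–(8) at `T > 0` — `f^r_q² = e₀E^r_q/12E^r_{q-Q}` uses
`ρ₁ ≤ e₀'/2`, i.e. (P)+(S) — which is what the remark on p. 1020 ("the techniques we use may be
combined with the techniques of Dyson et al. for nonzero temperatures to prove the existence of a
phase transition for `1 ≥ r ≥ 0.16`") requires for `S = ½`.

## Contents (every `d`, spin `S = n/2`, `β > 0`; side `L ≥ 3`, resp. even side `2k ≥ 4` for (P))

* (Sᵀ) `gibbsSpinCorr_anisoHeis_comp_perm`, `gibbsDirBondCorr_anisoHeis_comp_perm`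
  (`εᵢ(β, K∘s) = ε_{s i}(β, K)`), `gibbsDirBondCorr_anisoHeis_eq_of_coupling_eq`;
* (Xᵀ) `sub_mul_sub_gibbsDirBondCorr_nonpos` — `(K_a - K_b)(ε_a(β) - ε_b(β)) ≤ 0`;
  `gibbsDirBondCorr_anisoHeis_le_of_coupling_le`;
* (Pᵀ) `log_partitionFn_heisAniso_couplingOff_le` (`Z_β(H_{K^{(i)}}) ≤ Z_β(H_K)`),
  `mul_gibbsDirBondCorr_nonpos` — `Kᵢ εᵢ(β) ≤ 0`; `gibbsDirBondCorr_anisoHeis_nonpos`;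
* the thermal energy window `heisAniso_thermal_energy_window`
  (`(S²/3)ΣK - log(n+1)/(3β) ≤ e(β) ≤ S²ΣK`, `e(β) := -ΣᵢKᵢεᵢ(β)`) and
  `mul_neg_gibbsDirBondCorr_le_energy` (`κ_T(-ε_{i₀}(β)) ≤ e(β)`);
* **`heisAniso_twoSumRule_thermal_max`**, **`heisAniso_twoSumRule_thermal_kls`** — the thermal
  two-sum-rule bound with `s = -ε_{i₀}(β)` (largest coupling) and in KLS's one-parameter form
  `t·S(S+1)/3 - λe - (e/2κ_T)^{1/2}𝓦^K_{t,λK}(L) - (2β)⁻¹𝓣^K_{t,λK}(L) ≤ (t - λΣK)·m_L(β)`.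

## References

* [KLS1988JSP] T. Kennedy, E. H. Lieb, B. S. Shastry, J. Stat. Phys. 53 (1988) 1019–1030, p. 1020,
  eqs. (5)–(9), pp. 1023–1024, 1026.
* [DLS1978] F. J. Dyson, E. H. Lieb, B. Simon, J. Stat. Phys. 18 (1978) 335–383, §6, App. C
  (energetic a-priori bounds at `T > 0`).
* [Simon1993] B. Simon, *The Statistical Mechanics of Lattice Gases* I, Princeton 1993, Thm. I.4.1
  / §II.9 (Peierls–Bogoliubov and Bogoliubov convexity inequalities) — used through the tree's
  `Matrix.peierls_bogoliubov` [folklore].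
-/

noncomputable section

open Matrix Finset Filter Topology
open scoped ComplexOrder
open Literature.MathematicalPhysics.QuantumLattice Literature.MathematicalPhysics.QuantumLattice.SpinOperators
  Literature.Probability.LatticeModels

namespace Literature.MathematicalPhysics.QuantumLattice

variable {d : ℕ}

/-! ### Peierls–Bogoliubov in logarithmic form and invariances of the Gibbs state -/

section Tools

variable {m l : Type*} [Fintype m] [DecidableEq m] [Fintype l] [DecidableEq l]

/-- **Peierls–Bogoliubov in logarithmic form**: `log Z(H) - β Re⟨W⟩_H ≤ log Z(H + W)` for
Hermitian `H`, `W` (concavity of the free energy; the tree's `Matrix.peierls_bogoliubov`).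
[folklore] -/
private theorem log_partitionFn_peierlsBogoliubov [Nonempty m] {H W : Matrix m m ℂ} (hH : H.IsHermitian)
    (hW : W.IsHermitian) (β : ℝ) :
    Real.log (partitionFn β H).re - β * (gibbsState β H W).re ≤
      Real.log (partitionFn β (H + W)).re := by
  have h := peierls_bogoliubov hH hW β
  have hZ : 0 < (partitionFn β H).re := (Matrix.partitionFn_re_pos β hH).1
  have h2 : Real.log ((partitionFn β H).re * Real.exp (-(β * (gibbsState β H W).re))) ≤
      Real.log (partitionFn β (H + W)).re :=
    Real.log_le_log (mul_pos hZ (Real.exp_pos _)) h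
  rw [Real.log_mul hZ.ne' (Real.exp_pos _).ne', Real.log_exp] at h2
  linarith

/-- **Consequence for a symmetric perturbation**: if `Z(H + W) = Z(H)` then `Re⟨W⟩_H ≥ 0`
(`β > 0`). [folklore] -/
private theorem re_gibbsState_nonneg_of_partitionFn_add_eq [Nonempty m] {H W : Matrix m m ℂ}
    (hH : H.IsHermitian) (hW : W.IsHermitian) {β : ℝ} (hβ : 0 < β)
    (hZ : (partitionFn β (H + W)).re ≤ (partitionFn β H).re) :
    0 ≤ (gibbsState β H W).re := by
  have h := log_partitionFn_peierlsBogoliubov hH hW β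
  have hZ' : 0 < (partitionFn β (H + W)).re := (Matrix.partitionFn_re_pos β (hH.add hW)).1
  have hlog := Real.log_le_log hZ' hZ
  have hβW : 0 ≤ β * (gibbsState β H W).re := by linarith
  exact (mul_nonneg_iff_of_pos_left hβ).1 hβW

/-- The Gibbs state is covariant under a relabelling of the index set:
`⟨O∘(e×e)⟩_{β,A∘(e×e)} = ⟨O⟩_{β,A}`. [folklore] -/
private theorem gibbsState_submatrix_equiv_anisoHeis (β : ℝ) (H A : Matrix m m ℂ) (e : l ≃ m) :
    gibbsState β (H.submatrix e e) (A.submatrix e e) = gibbsState β H A := by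
  rw [gibbsState_apply, gibbsState_apply, Matrix.partitionFn_submatrix_equiv, gibbsWeight, gibbsWeight,
    show -(β : ℂ) • H.submatrix e e = (-(β : ℂ) • H).submatrix e e from rfl,
    Matrix.exp_submatrix_equiv, submatrix_mul_equiv, Matrix.trace_submatrix_equiv]

end Tools

/-! ### (Sᵀ), (Xᵀ): permutations of the coordinate axes -/

section AxisPermutation

variable (L : ℕ) [NeZero L] (n : ℕ)

/-- **Covariance of the thermal two-point function under relabelling of the axes**:
`G^α_{β,K∘s}(x∘s, y∘s) = G^α_{β,K}(x, y)` (`L ≥ 3`). [cite: KLS1988JSP, p. 1026] -/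
theorem gibbsSpinCorr_anisoHeis_comp_perm (hL3 : 3 ≤ L) (K : Fin d → ℝ) (β : ℝ)
    (s : Equiv.Perm (Fin d)) (α : Fin 3) (x y : TorusSite d L) :
    gibbsSpinCorr β (heisAnisoTorus L n (K ∘ s)) α (x ∘ s) (y ∘ s) =
      gibbsSpinCorr β (heisAnisoTorus L n K) α x y := by
  set π : TorusSite d L ≃ TorusSite d L := Equiv.arrowCongr s.symm (Equiv.refl (ZMod L)) with hπ
  have hH : (heisAnisoTorus L n K).submatrix (fun σ => σ ∘ π) (fun σ => σ ∘ π) =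
      heisAnisoTorus L n (K ∘ s) :=
    heisAnisoTorus_submatrix_comp_perm L n hL3 K s
  have hO : (siteSpin n x α * siteSpin n y α).submatrix (fun σ => σ ∘ π) (fun σ => σ ∘ π) =
      siteSpin n (x ∘ s) α * siteSpin n (y ∘ s) α := by
    rw [Matrix.submatrix_mul _ _ _ _ _ (bijective_comp_equiv (q := n + 1) π),
      siteSpin_submatrix_comp, siteSpin_submatrix_comp]
    rfl
  have key : gibbsState β ((heisAnisoTorus L n K).submatrix (fun σ => σ ∘ π) (fun σ => σ ∘ π))
      ((siteSpin n x α * siteSpin n y α).submatrix (fun σ => σ ∘ π) (fun σ => σ ∘ π)) =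
      gibbsState β (heisAnisoTorus L n K) (siteSpin n x α * siteSpin n y α) :=
    gibbsState_submatrix_equiv_anisoHeis β (heisAnisoTorus L n K) (siteSpin n x α * siteSpin n y α)
      (Equiv.arrowCongr π.symm (Equiv.refl (Fin (n + 1))))
  rw [gibbsSpinCorr, gibbsSpinCorr, ← hH, ← hO]
  exact congrArg Complex.re key

/-- **The thermal bond correlations of the relabelled model**: `εᵢ(β, K∘s) = ε_{s i}(β, K)`.
[cite: KLS1988JSP, p. 1026] -/
theorem gibbsDirBondCorr_anisoHeis_comp_perm (hL3 : 3 ≤ L) (K : Fin d → ℝ) (β : ℝ)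
    (s : Equiv.Perm (Fin d)) (α : Fin 3) (i : Fin d) :
    gibbsDirBondCorr β (heisAnisoTorus L n (K ∘ s)) α i =
      gibbsDirBondCorr β (heisAnisoTorus L n K) α (s i) := by
  have hsi : s.symm (s i) = i := Equiv.symm_apply_apply s i
  have hsum : ∑ x : TorusSite d L, gibbsSpinCorr β (heisAnisoTorus L n (K ∘ s)) α x (x + Pi.single i 1) =
      ∑ z : TorusSite d L, gibbsSpinCorr β (heisAnisoTorus L n K) α z (z + Pi.single (s i) 1) :=
    calc ∑ x : TorusSite d L, gibbsSpinCorr β (heisAnisoTorus L n (K ∘ s)) α x (x + Pi.single i 1)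
        = ∑ z : TorusSite d L, gibbsSpinCorr β (heisAnisoTorus L n (K ∘ s)) α (z ∘ s)
            ((z ∘ s : TorusSite d L) + Pi.single i 1) :=
          ((Equiv.arrowCongr s.symm (Equiv.refl (ZMod L))).sum_comp
            (fun x => gibbsSpinCorr β (heisAnisoTorus L n (K ∘ s)) α x (x + Pi.single i 1))).symm
      _ = ∑ z : TorusSite d L, gibbsSpinCorr β (heisAnisoTorus L n K) α z (z + Pi.single (s i) 1) :=
          sum_congr rfl fun z _ => by
            rw [← gibbsSpinCorr_anisoHeis_comp_perm L n hL3 K β s α z (z + Pi.single (s i) 1),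
              add_single_comp_perm, hsi]
  rw [gibbsDirBondCorr, gibbsDirBondCorr, hsum]

/-- **(Sᵀ) Equal couplings give equal thermal bond correlations**: `K_a = K_b ⇒ ε_a(β) = ε_b(β)`
([KLS1988JSP] p. 1024: "The two cases of `i = 1` or `2` give the same result because of the
invariance under rotations of the lattice by `π/2`", here for the Gibbs state).
[cite: KLS1988JSP, pp. 1024, 1026] -/
theorem gibbsDirBondCorr_anisoHeis_eq_of_coupling_eq (hL3 : 3 ≤ L) (K : Fin d → ℝ) (β : ℝ)
    (α : Fin 3) {a b : Fin d} (hab : K a = K b) :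
    gibbsDirBondCorr β (heisAnisoTorus L n K) α a = gibbsDirBondCorr β (heisAnisoTorus L n K) α b := by
  have hK : K ∘ Equiv.swap a b = K := by
    ext i
    simp only [Function.comp_apply]
    rcases eq_or_ne i a with rfl | hia
    · rw [Equiv.swap_apply_left, hab]
    · rcases eq_or_ne i b with rfl | hib
      · rw [Equiv.swap_apply_right, hab]
      · rw [Equiv.swap_apply_of_ne_of_ne hia hib]
  have h := gibbsDirBondCorr_anisoHeis_comp_perm L n hL3 K β (Equiv.swap a b) α a
  rw [hK, Equiv.swap_apply_left] at h
  exact h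

/-- **`Z_β(H_{K∘s}) = Z_β(H_K)`** for a permutation `s` of the axes (relabelling of the tensor
indices). [cite: KLS1988JSP, p. 1026] -/
theorem partitionFn_heisAniso_comp_perm (hL3 : 3 ≤ L) (K : Fin d → ℝ) (β : ℝ)
    (s : Equiv.Perm (Fin d)) :
    partitionFn β (heisAnisoTorus L n (K ∘ s)) = partitionFn β (heisAnisoTorus L n K) := by
  set π : TorusSite d L ≃ TorusSite d L := Equiv.arrowCongr s.symm (Equiv.refl (ZMod L)) with hπ
  have hsub : (heisAnisoTorus L n K).submatrix (fun σ => σ ∘ π) (fun σ => σ ∘ π) =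
      heisAnisoTorus L n (K ∘ s) :=
    heisAnisoTorus_submatrix_comp_perm L n hL3 K s
  have hZ : partitionFn β ((heisAnisoTorus L n K).submatrix (fun σ => σ ∘ π) (fun σ => σ ∘ π)) =
      partitionFn β (heisAnisoTorus L n K) :=
    Matrix.partitionFn_submatrix_equiv β (heisAnisoTorus L n K)
      (Equiv.arrowCongr π.symm (Equiv.refl (Fin (n + 1))))
  rw [hsub] at hZ
  exact hZ

/-- **(Xᵀ) The axis-exchange inequality at positive temperature**: for any two axes `a, b` and
every `β > 0`, `(K_a - K_b)(ε_a(β) - ε_b(β)) ≤ 0` — the more strongly coupled direction has the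
more negative thermal bond correlation ([KLS1988JSP] p. 1026 "rotate the lattice … Thus `ρ₃ ≤ ρ₁`",
at `T > 0`: Peierls–Bogoliubov `log Z(H_K) - β⟨H_{K∘(ab)} - H_K⟩_K ≤ log Z(H_{K∘(ab)}) = log Z(H_K)`
gives `⟨H_{K∘(ab)}⟩_K ≥ ⟨H_K⟩_K`, i.e. `Σᵢ(K_{(ab)i} - Kᵢ)εᵢ(β) ≥ 0`).
[cite: KLS1988JSP, p. 1026] [cite: DLS1978, App. C] -/
theorem sub_mul_sub_gibbsDirBondCorr_nonpos (hL3 : 3 ≤ L) (K : Fin d → ℝ) {β : ℝ} (hβ : 0 < β)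
    (a b : Fin d) :
    (K a - K b) * (gibbsDirBondCorr β (heisAnisoTorus L n K) 0 a -
      gibbsDirBondCorr β (heisAnisoTorus L n K) 0 b) ≤ 0 := by
  rcases eq_or_ne a b with rfl | hab
  · simp
  haveI : Nonempty (TensorIndex (TorusSite d L) (n + 1)) := ⟨fun _ => 0⟩
  have hLd : (0 : ℝ) < (L : ℝ) ^ d := by
    have : (0 : ℝ) < L := by exact_mod_cast Nat.pos_of_ne_zero (NeZero.ne L)
    positivity
  set s := Equiv.swap a b with hs
  have hHh : (heisAnisoTorus L n K).IsHermitian := heisAnisoTorus_isHermitian L n K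
  have hH'h : (heisAnisoTorus L n (K ∘ s)).IsHermitian := heisAnisoTorus_isHermitian L n (K ∘ s)
  -- Peierls–Bogoliubov with the symmetric perturbation `W = H_{K∘s} - H_K`
  have hZ : (partitionFn β (heisAnisoTorus L n K + (heisAnisoTorus L n (K ∘ s) - heisAnisoTorus L n K))).re ≤
      (partitionFn β (heisAnisoTorus L n K)).re := by
    rw [add_sub_cancel, partitionFn_heisAniso_comp_perm L n hL3 K β s]
  have hW := re_gibbsState_nonneg_of_partitionFn_add_eq hHh (hH'h.sub hHh) hβ hZ
  rw [map_sub, Complex.sub_re, re_gibbsState_heisAnisoTorus L n (K ∘ s) β hL3 K,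
    re_gibbsState_heisAnisoTorus L n K β hL3 K] at hW
  -- `Σᵢ Kᵢ εᵢ ≤ Σᵢ K_{s i} εᵢ`; the two sums differ only in the terms `i = a, b`
  have hsum : ∑ i, K i * gibbsDirBondCorr β (heisAnisoTorus L n K) 0 i ≤
      ∑ i, (K ∘ s) i * gibbsDirBondCorr β (heisAnisoTorus L n K) 0 i :=
    le_of_mul_le_mul_left (by linarith) (by positivity : (0 : ℝ) < 3 * (L : ℝ) ^ d)
  have hsplit : ∀ f : Fin d → ℝ, ∑ i, f i = f a + f b + ∑ i ∈ (univ.erase a).erase b, f i := by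
    intro f
    rw [← add_sum_erase _ _ (mem_univ a), ← add_sum_erase _ _ (mem_erase.2 ⟨hab.symm, mem_univ b⟩),
      add_assoc]
  have hrest : ∑ i ∈ (univ.erase a).erase b, (K ∘ s) i * gibbsDirBondCorr β (heisAnisoTorus L n K) 0 i =
      ∑ i ∈ (univ.erase a).erase b, K i * gibbsDirBondCorr β (heisAnisoTorus L n K) 0 i := by
    refine sum_congr rfl fun i hi => ?_
    obtain ⟨hib, hia⟩ := mem_erase.1 hi
    rw [Function.comp_apply, hs, Equiv.swap_apply_of_ne_of_ne (mem_erase.1 hia).1 hib]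
  rw [hsplit, hsplit (fun i => (K ∘ s) i * gibbsDirBondCorr β (heisAnisoTorus L n K) 0 i), hrest,
    Function.comp_apply, Function.comp_apply, hs, Equiv.swap_apply_left, Equiv.swap_apply_right] at hsum
  nlinarith [hsum]

/-- **The largest coupling has the most negative thermal bond correlation**:
`K_b ≤ K_a ⇒ ε_a(β) ≤ ε_b(β)` ((Xᵀ) for `K_b < K_a`, (Sᵀ) for `K_b = K_a`). For `K = (1,1,r)`,
`r ≤ 1`: KLS's "`ρ₃ ≤ ρ₁`" at `T > 0`. [cite: KLS1988JSP, p. 1026] -/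
theorem gibbsDirBondCorr_anisoHeis_le_of_coupling_le (hL3 : 3 ≤ L) (K : Fin d → ℝ) {β : ℝ}
    (hβ : 0 < β) {a b : Fin d} (hba : K b ≤ K a) :
    gibbsDirBondCorr β (heisAnisoTorus L n K) 0 a ≤ gibbsDirBondCorr β (heisAnisoTorus L n K) 0 b := by
  rcases hba.lt_or_eq with hlt | heq
  · have h := sub_mul_sub_gibbsDirBondCorr_nonpos L n hL3 K hβ a b
    have hpos : 0 < K a - K b := sub_pos.2 hlt
    nlinarith [h, hpos]
  · exact (gibbsDirBondCorr_anisoHeis_eq_of_coupling_eq L n hL3 K β 0 heq.symm).le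

end AxisPermutation

/-! ### (Pᵀ): `Kᵢ εᵢ(β) ≤ 0` by the plane flips and convexity of `log Z` -/

section Sign

variable (k : ℕ) [NeZero (2 * k)] (n : ℕ)

/-- **Switching off a coupling lowers the partition function**: `log Z_β(H_{K^{(i)}}) ≤ log Z_β(H_K)`
(`2k ≥ 4`, `β` real). From the plane-flip average `H_K + Σ_a W_aH_KW_a⁻¹ = 4H_{K^{(i)}}`
(`heisAnisoTorus_add_sum_planeFlip`), unitary invariance of `Z` and convexity of `log Z`
(Peierls–Bogoliubov at the average point, summed over the four conjugates). This is the `T > 0`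
form of `heisAnisoTorus_groundEnergy_le_couplingOff` (`E₀(H_K) ≤ E₀(H_{K^{(i)}})`).
[cite: KLS1988JSP, p. 1026] [cite: DLS1978, App. C] -/
theorem log_partitionFn_heisAniso_couplingOff_le (hL3 : 3 ≤ 2 * k) (K : Fin d → ℝ) (i : Fin d)
    (β : ℝ) :
    Real.log (partitionFn β (heisAnisoTorus (2 * k) n (couplingOff K i))).re ≤
      Real.log (partitionFn β (heisAnisoTorus (2 * k) n K)).re := by
  haveI : Nonempty (TensorIndex (TorusSite d (2 * k)) (n + 1)) := ⟨fun _ => 0⟩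
  have hex := fun a : Fin 3 => exists_piRotation n a
  choose R hR hR' hc using hex
  set W : Fin 3 → Op (TorusSite d (2 * k)) (n + 1) := fun a =>
    productOp (fun z : TorusSite d (2 * k) => if planeParity k i z = 0 then 1 else R a) with hW
  have hWu : ∀ a, W a * (W a)ᴴ = 1 := by
    intro a
    simp only [hW]
    refine productOp_mul_conjTranspose fun z => ?_
    split_ifs
    · rw [conjTranspose_one, Matrix.mul_one]
    · exact hR a
  have hWmem : ∀ a, W a ∈ Matrix.unitaryGroup (TensorIndex (TorusSite d (2 * k)) (n + 1)) ℂ :=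
    fun a => Matrix.mem_unitaryGroup_iff.2 (hWu a)
  set H := heisAnisoTorus (2 * k) n K with hH
  set H₀ := heisAnisoTorus (2 * k) n (couplingOff K i) with hH₀
  have hHh : H.IsHermitian := heisAnisoTorus_isHermitian (2 * k) n K
  have hH₀h : H₀.IsHermitian := heisAnisoTorus_isHermitian (2 * k) n _
  have hconjH : ∀ a, (W a * H * (W a)ᴴ).IsHermitian := fun a =>
    isHermitian_mul_mul_conjTranspose _ hHh
  have havg : H + ∑ a : Fin 3, W a * H * (W a)ᴴ = (4 : ℂ) • H₀ := by
    simp only [hW, hH, hH₀]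
    exact heisAnisoTorus_add_sum_planeFlip k n hL3 K i R hR hR' hc
  -- unitary invariance of `Z`
  have hZa : ∀ a, partitionFn β (W a * H * (W a)ᴴ) = partitionFn β H := fun a => by
    have h := partitionFn_unitary_conj (hWmem a) β H
    rw [star_eq_conjTranspose] at h
    exact h
  -- Peierls–Bogoliubov at `H₀` towards `H` and towards each `W_a H W_a⁻¹`
  have hpb0 := log_partitionFn_peierlsBogoliubov hH₀h (hHh.sub hH₀h) β
  rw [add_sub_cancel] at hpb0
  have hpba : ∀ a, Real.log (partitionFn β H₀).re - β * (gibbsState β H₀ (W a * H * (W a)ᴴ - H₀)).re ≤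
      Real.log (partitionFn β H).re := by
    intro a
    have h := log_partitionFn_peierlsBogoliubov hH₀h ((hconjH a).sub hH₀h) β
    rw [add_sub_cancel, hZa a] at h
    exact h
  -- the four perturbations sum to zero in expectation
  have hzero : (H - H₀) + ∑ a, (W a * H * (W a)ᴴ - H₀) = 0 := by
    rw [sum_sub_distrib, sum_const, card_univ, Fintype.card_fin, eq_sub_of_add_eq' havg]
    module
  have hE : (gibbsState β H₀ (H - H₀)).re + ∑ a, (gibbsState β H₀ (W a * H * (W a)ᴴ - H₀)).re = 0 := by
    have h := congrArg (fun X => (gibbsState β H₀ X).re) hzero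
    simp only [map_add, map_sum, map_zero, Complex.add_re, Complex.re_sum, Complex.zero_re] at h
    exact h
  have hs := sum_le_sum fun a (_ : a ∈ (univ : Finset (Fin 3))) => hpba a
  rw [sum_sub_distrib, sum_const, card_univ, Fintype.card_fin, sum_const, card_univ,
    Fintype.card_fin, ← mul_sum] at hs
  simp only [nsmul_eq_mul, Nat.cast_ofNat] at hs
  have hβE : β * (gibbsState β H₀ (H - H₀)).re +
      β * ∑ a, (gibbsState β H₀ (W a * H * (W a)ᴴ - H₀)).re = 0 := by
    rw [← mul_add, hE, mul_zero]
  linarith [hpb0, hs, hβE]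

/-- **(Pᵀ) The thermal bond correlations of the antiferromagnet have the antiferromagnetic sign**:
`Kᵢ εᵢ(β) ≤ 0` for every direction `i`, every spin, every `K`, every `β > 0`, on the even torus of
side `2k ≥ 4` — KLS's "`ρ₃ ≥ 0`" (p. 1026) at `T > 0`:
`log Z(H_K) - β⟨H_{K^{(i)}} - H_K⟩_K ≤ log Z(H_{K^{(i)}}) ≤ log Z(H_K)` and
`⟨H_{K^{(i)}} - H_K⟩_K = -3|Λ|Kᵢεᵢ(β)`. [cite: KLS1988JSP, p. 1026] [cite: DLS1978, App. C] -/
theorem mul_gibbsDirBondCorr_nonpos (hL3 : 3 ≤ 2 * k) (K : Fin d → ℝ) {β : ℝ} (hβ : 0 < β)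
    (i : Fin d) :
    K i * gibbsDirBondCorr β (heisAnisoTorus (2 * k) n K) 0 i ≤ 0 := by
  haveI : Nonempty (TensorIndex (TorusSite d (2 * k)) (n + 1)) := ⟨fun _ => 0⟩
  have hLd : (0 : ℝ) < (((2 * k : ℕ) : ℝ)) ^ d := by
    have : (0 : ℝ) < ((2 * k : ℕ) : ℝ) := by exact_mod_cast (show 0 < 2 * k by omega)
    positivity
  have hHh : (heisAnisoTorus (2 * k) n K).IsHermitian := heisAnisoTorus_isHermitian (2 * k) n K
  have hH₀h : (heisAnisoTorus (2 * k) n (couplingOff K i)).IsHermitian :=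
    heisAnisoTorus_isHermitian (2 * k) n _
  -- `Z(H_K + (H₀ - H_K)) = Z(H₀) ≤ Z(H_K)`
  have hZ : (partitionFn β (heisAnisoTorus (2 * k) n K +
      (heisAnisoTorus (2 * k) n (couplingOff K i) - heisAnisoTorus (2 * k) n K))).re ≤
      (partitionFn β (heisAnisoTorus (2 * k) n K)).re := by
    rw [add_sub_cancel]
    have hlog := log_partitionFn_heisAniso_couplingOff_le k n hL3 K i β
    have hZ₀ : 0 < (partitionFn β (heisAnisoTorus (2 * k) n (couplingOff K i))).re :=
      (Matrix.partitionFn_re_pos β hH₀h).1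
    have hZ₁ : 0 < (partitionFn β (heisAnisoTorus (2 * k) n K)).re :=
      (Matrix.partitionFn_re_pos β hHh).1
    exact (Real.log_le_log_iff hZ₀ hZ₁).1 hlog
  have hW := re_gibbsState_nonneg_of_partitionFn_add_eq hHh (hH₀h.sub hHh) hβ hZ
  rw [map_sub, Complex.sub_re, re_gibbsState_heisAnisoTorus (2 * k) n (couplingOff K i) β hL3 K,
    re_gibbsState_heisAnisoTorus (2 * k) n K β hL3 K] at hW
  have hoff : ∀ j, couplingOff K i j * gibbsDirBondCorr β (heisAnisoTorus (2 * k) n K) 0 j =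
      K j * gibbsDirBondCorr β (heisAnisoTorus (2 * k) n K) 0 j -
        if j = i then K j * gibbsDirBondCorr β (heisAnisoTorus (2 * k) n K) 0 j else 0 := by
    intro j
    by_cases hji : j = i
    · subst hji; simp [couplingOff]
    · simp [couplingOff, hji]
  simp_rw [hoff, sum_sub_distrib, sum_ite_eq', if_pos (mem_univ _)] at hW
  have h3 : 3 * (((2 * k : ℕ) : ℝ)) ^ d * (K i * gibbsDirBondCorr β (heisAnisoTorus (2 * k) n K) 0 i) ≤ 0 := by
    linarith
  exact nonpos_of_mul_nonpos_right h3 (by positivity)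

/-- **(Pᵀ), divided**: `εᵢ(β) ≤ 0` in every direction with `Kᵢ > 0` ("`ρ₃ ≥ 0`" at `T > 0`).
[cite: KLS1988JSP, p. 1026] -/
theorem gibbsDirBondCorr_anisoHeis_nonpos (hL3 : 3 ≤ 2 * k) {K : Fin d → ℝ} {β : ℝ} (hβ : 0 < β)
    {i : Fin d} (hKi : 0 < K i) :
    gibbsDirBondCorr β (heisAnisoTorus (2 * k) n K) 0 i ≤ 0 :=
  nonpos_of_mul_nonpos_right (mul_gibbsDirBondCorr_nonpos k n hL3 K hβ i) hKi

/-- **`-εᵢ(β) ≤ -ε_{i₀}(β)` for a direction `i₀` of a largest coupling** (all `i`; `K > 0`).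
[cite: KLS1988JSP, p. 1026] -/
theorem neg_gibbsDirBondCorr_le_of_isMax (hL3 : 3 ≤ 2 * k) (K : Fin d → ℝ) {β : ℝ} (hβ : 0 < β)
    {i₀ : Fin d} (hmax : ∀ i, K i ≤ K i₀) (i : Fin d) :
    -gibbsDirBondCorr β (heisAnisoTorus (2 * k) n K) 0 i ≤
      -gibbsDirBondCorr β (heisAnisoTorus (2 * k) n K) 0 i₀ :=
  neg_le_neg (gibbsDirBondCorr_anisoHeis_le_of_coupling_le (2 * k) n hL3 K hβ (hmax i))

/-- `κ_T · (-ε_{i₀}(β)) ≤ e(β)` for a set `T` of directions carrying the largest coupling, with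
`e(β) := -Σᵢ Kᵢεᵢ(β)` ((Pᵀ): all terms nonnegative; (Sᵀ): equal couplings, equal correlations). For
`K = (1,1,r)`, `T = {1,2}`: `ρ₁ ≤ e₀'/2` at `T > 0`. [cite: KLS1988JSP, p. 1026] -/
theorem mul_neg_gibbsDirBondCorr_le_energy (hL3 : 3 ≤ 2 * k) (K : Fin d → ℝ) {β : ℝ} (hβ : 0 < β)
    {i₀ : Fin d} (T : Finset (Fin d)) (hT : ∀ i ∈ T, K i = K i₀) :
    (∑ i ∈ T, K i) * (-gibbsDirBondCorr β (heisAnisoTorus (2 * k) n K) 0 i₀) ≤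
      -∑ i, K i * gibbsDirBondCorr β (heisAnisoTorus (2 * k) n K) 0 i := by
  have hTi : ∀ i ∈ T, gibbsDirBondCorr β (heisAnisoTorus (2 * k) n K) 0 i =
      gibbsDirBondCorr β (heisAnisoTorus (2 * k) n K) 0 i₀ :=
    fun i hi => gibbsDirBondCorr_anisoHeis_eq_of_coupling_eq (2 * k) n hL3 K β 0 (hT i hi)
  calc (∑ i ∈ T, K i) * (-gibbsDirBondCorr β (heisAnisoTorus (2 * k) n K) 0 i₀)
      = ∑ i ∈ T, -(K i * gibbsDirBondCorr β (heisAnisoTorus (2 * k) n K) 0 i) := by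
        rw [sum_mul]
        exact sum_congr rfl fun i hi => by rw [hTi i hi]; ring
    _ ≤ ∑ i, -(K i * gibbsDirBondCorr β (heisAnisoTorus (2 * k) n K) 0 i) :=
        sum_le_sum_of_subset_of_nonneg (subset_univ T) fun i _ _ =>
          neg_nonneg.2 (mul_gibbsDirBondCorr_nonpos k n hL3 K hβ i)
    _ = -∑ i, K i * gibbsDirBondCorr β (heisAnisoTorus (2 * k) n K) 0 i := by rw [sum_neg_distrib]

/-- **The a-priori window of the thermal energy** `e(β) := -Σᵢ Kᵢ εᵢ(β)` (`= e₀(β)/3`):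
`(S²/3)ΣᵢKᵢ - log(n+1)/(3β) ≤ e(β) ≤ S²ΣᵢKᵢ` for `K ≥ 0`, `β > 0` — the Néel energy–entropy bound
(Nᵀ) below and the operator bound (T) above ([KLS1988JSP] p. 1023 "`e₀` ranging from the Néel bound
… to the Anderson bound", at `T > 0` with the entropy term of [DLS1978] §6).
[cite: KLS1988JSP, p. 1023] [cite: DLS1978, §6] -/
theorem heisAniso_thermal_energy_window (hL3 : 3 ≤ 2 * k) {K : Fin d → ℝ} (hK : ∀ i, 0 ≤ K i)
    {β : ℝ} (hβ : 0 < β) :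
    ((n : ℝ) / 2) ^ 2 / 3 * ∑ i, K i - Real.log (n + 1) / (3 * β) ≤
        -∑ i, K i * gibbsDirBondCorr β (heisAnisoTorus (2 * k) n K) 0 i ∧
      -∑ i, K i * gibbsDirBondCorr β (heisAnisoTorus (2 * k) n K) 0 i ≤ ((n : ℝ) / 2) ^ 2 * ∑ i, K i := by
  refine ⟨by linarith [heisAniso_thermal_neelBound k n hL3 K hβ], ?_⟩
  rw [← sum_neg_distrib, mul_sum]
  refine sum_le_sum fun i _ => ?_
  have h := abs_gibbsDirBondCorr_le β (heisAnisoTorus_isHermitian (2 * k) n K) 0 i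
  rw [abs_le] at h
  nlinarith [h.1, hK i]

end Sign

/-! ### The thermal two-sum-rule bound in Kennedy–Lieb–Shastry's one-parameter form -/

section KLSForm

variable (k : ℕ) [NeZero (2 * k)] (n : ℕ)

/-- **The thermal two-sum-rule bound with the largest-coupling correlation** (`s = -ε_{i₀}(β)`,
KLS's "`0 ≤ ρ₃ ≤ ρ₁`" at `T > 0`). [cite: KLS1988JSP, eqs. (6)-(9), p. 1026] [cite: DLS1978, Thm. 6.1] -/
theorem heisAniso_twoSumRule_thermal_max (hk : 2 ≤ k) {K : Fin d → ℝ} (hK : ∀ i, 0 < K i)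
    {β : ℝ} (hβ : 0 < β) {i₀ : Fin d} (hmax : ∀ i, K i ≤ K i₀) (t : ℝ) (μ : Fin d → ℝ) :
    t * ((n : ℝ) / 2 * ((n : ℝ) / 2 + 1) / 3) +
          ∑ i, μ i * gibbsDirBondCorr β (heisAnisoTorus (2 * k) n K) 0 i -
        Real.sqrt (-gibbsDirBondCorr β (heisAnisoTorus (2 * k) n K) 0 i₀ / 2) *
          heisAnisoKlsRiemannSum K t μ (2 * k) -
        1 / (2 * β) * heisAnisoThermalRiemannSum K t μ (2 * k) ≤
      (t - ∑ i, μ i) *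
        (gibbsStructureFactor β (heisAnisoTorus (2 * k) n K) 0 (neelIndex (2 * k)) /
          ((2 * k : ℕ) : ℝ) ^ d) := by
  have hL3 : 3 ≤ 2 * k := by omega
  exact heisAniso_twoSumRule_thermal n k hk hK hβ t μ
    (neg_nonneg.2 (gibbsDirBondCorr_anisoHeis_nonpos k n hL3 hβ (hK i₀)))
    (neg_gibbsDirBondCorr_le_of_isMax k n hL3 K hβ hmax)

/-- **Kennedy–Lieb–Shastry's (6)–(8) at positive temperature, finite volume, dual form, the energy
as the unknown.** On the even torus of side `2k ≥ 4`, every `d`, every spin `S = n/2`, every `K > 0`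
with a largest coupling `K_{i₀}` carried by the directions of `T` (`κ_T = Σ_{i∈T}Kᵢ > 0`), every
`β > 0` and every real `t`, `λ`: with `e := -Σᵢ Kᵢ εᵢ(β)` and the multipliers `μ = λK` of (8),
`t·S(S+1)/3 - λe - (e/2κ_T)^{1/2} 𝓦^K_{t,λK}(L) - (2β)⁻¹ 𝓣^K_{t,λK}(L) ≤ (t - λΣᵢKᵢ)·|Λ|⁻¹ĝ_Q(β)`
— the printed programme (`f^r_q² = e₀E^r_q/12E^r_{q-Q}`, kernel `t + λ(cos q₁ + cos q₂ + r cos q₃)`)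
plus the Dyson–Lieb–Simon term: the combination announced on [KLS1988JSP] p. 1020.
[cite: KLS1988JSP, p. 1020, eqs. (5)-(9), p. 1026] [cite: DLS1978, Thms. 5.1, 6.1, 6.2] -/
theorem heisAniso_twoSumRule_thermal_kls (hk : 2 ≤ k) {K : Fin d → ℝ} (hK : ∀ i, 0 < K i)
    {β : ℝ} (hβ : 0 < β) {i₀ : Fin d} (hmax : ∀ i, K i ≤ K i₀) (T : Finset (Fin d))
    (hT : ∀ i ∈ T, K i = K i₀) (hκ : 0 < ∑ i ∈ T, K i) (t lam : ℝ) :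
    t * ((n : ℝ) / 2 * ((n : ℝ) / 2 + 1) / 3) -
          lam * (-∑ i, K i * gibbsDirBondCorr β (heisAnisoTorus (2 * k) n K) 0 i) -
        Real.sqrt (-(∑ i, K i * gibbsDirBondCorr β (heisAnisoTorus (2 * k) n K) 0 i) /
            (2 * ∑ i ∈ T, K i)) * heisAnisoKlsRiemannSum K t (fun i => lam * K i) (2 * k) -
        1 / (2 * β) * heisAnisoThermalRiemannSum K t (fun i => lam * K i) (2 * k) ≤
      (t - lam * ∑ i, K i) *
        (gibbsStructureFactor β (heisAnisoTorus (2 * k) n K) 0 (neelIndex (2 * k)) /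
          ((2 * k : ℕ) : ℝ) ^ d) := by
  have hL3 : 3 ≤ 2 * k := by omega
  set e := -∑ i, K i * gibbsDirBondCorr β (heisAnisoTorus (2 * k) n K) 0 i with he
  set s := -gibbsDirBondCorr β (heisAnisoTorus (2 * k) n K) 0 i₀ with hs
  have hs0 : 0 ≤ s := neg_nonneg.2 (gibbsDirBondCorr_anisoHeis_nonpos k n hL3 hβ (hK i₀))
  have hse : (∑ i ∈ T, K i) * s ≤ e := mul_neg_gibbsDirBondCorr_le_energy k n hL3 K hβ T hT
  have hmain := heisAniso_twoSumRule_thermal_max k n hk hK hβ hmax t (fun i => lam * K i)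
  have hμ : ∑ i, lam * K i * gibbsDirBondCorr β (heisAnisoTorus (2 * k) n K) 0 i = -(lam * e) := by
    rw [he, mul_neg, neg_neg, mul_sum]
    exact sum_congr rfl fun i _ => by ring
  have hμ' : ∑ i, lam * K i = lam * ∑ i, K i := by rw [mul_sum]
  rw [hμ, hμ'] at hmain
  -- `√(s/2) ≤ √(e/(2κ_T))` and `𝓦 ≥ 0`
  have hsqrt : Real.sqrt (s / 2) ≤ Real.sqrt (e / (2 * ∑ i ∈ T, K i)) := by
    refine Real.sqrt_le_sqrt ?_
    rw [div_le_div_iff₀ (by norm_num : (0 : ℝ) < 2) (by positivity)]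
    nlinarith [hse]
  have hW := heisAnisoKlsRiemannSum_nonneg K t (fun i => lam * K i) (2 * k)
  have hprod := mul_le_mul_of_nonneg_right hsqrt hW
  linarith [hmain, hprod]

end KLSForm

end Literature.MathematicalPhysics.QuantumLattice
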